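import Mathlib
import HarnessLib
import Literature.MathematicalPhysics.QuantumLattice.SchwartzTensorLineDeriv
import Literature.MathematicalPhysics.QuantumLattice.SchwartzNuclearExpansionBounds

/-!
# `CurvatureKernelBound` — stub A1 support: the derivative of a translation orbit in `𝓢`

Support file for crux `stmt-QuantumFields-11687` (`PencilRigidity.CurvatureKernelBound`), line
`sixteen-charts-analytic-kernel`, stub `ChartDerivativeBounds` (A1).  Pure analysis on the Schwartz
space `𝓢(V, ℂ)` of a real normed space `V`:

* `lineDerivOp_compSubConstCLM`, `lineDerivOp_comm`, `iteratedLineDerivOp_compSubConstCLM`,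
  `iteratedLineDerivOp_lineDerivOp`: line derivatives commute with translations and with each other;
* `norm_slope_translate_add_lineDeriv_le`: the second-order Taylor estimate along a line,
  `‖ε⁻¹ (Y(x − εw) − Y(x)) + (∂_w Y)(x)‖ ≤ |ε| · sup_{|s| ≤ 1} ‖(∂_w ∂_w Y)(x − s w)‖`;
* `seminorm_slope_translate_add_lineDeriv_le`: every Schwartz seminorm of the difference quotient
  `ε⁻¹ (Y(· − εw) − Y) + ∂_w Y` is `O(ε)`;
* `hasDerivAt_apply_compSubConstCLM_smul`: for a continuous linear functional `T` on `𝓢(V, ℂ)`,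
  `t ↦ T (Y(· − t w))` is differentiable with derivative `−T ((∂_w Y)(· − t w))`, and the iterated
  form `hasDerivAt_iterate_lineDerivOp_translate` used for the Osterwalder–Schrader semigroup estimate.
[folklore]
-/

noncomputable section

open scoped SchwartzMap LineDeriv Topology
open Filter Set
open Literature.MathematicalPhysics.QuantumLattice

namespace Summit.QuantumFields.YangMills.Theorems.CurvatureKernel

variable {V : Type*} [NormedAddCommGroup V] [NormedSpace ℝ V]

/-! ## Line derivatives commute with translations and with each other -/

/-- `∂_v (Y(· − a)) = (∂_v Y)(· − a)`. [folklore] -/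
theorem lineDerivOp_compSubConstCLM (a v : V) (Y : 𝓢(V, ℂ)) :
    (∂_{v} (SchwartzMap.compSubConstCLM ℂ a Y) : 𝓢(V, ℂ)) = SchwartzMap.compSubConstCLM ℂ a (∂_{v} Y) := by
  ext x
  rw [SchwartzMap.lineDerivOp_apply_eq_fderiv, SchwartzMap.compSubConstCLM_apply,
    SchwartzMap.lineDerivOp_apply_eq_fderiv]
  change fderiv ℝ (fun y => Y (y - a)) x v = _
  rw [fderiv_comp_sub]

/-- `∂_v ∂_w Y = ∂_w ∂_v Y` (symmetry of the second derivative of a smooth function). [folklore] -/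
theorem lineDerivOp_comm (v w : V) (Y : 𝓢(V, ℂ)) :
    (∂_{v} (∂_{w} Y) : 𝓢(V, ℂ)) = ∂_{w} (∂_{v} Y) := by
  ext x
  simp only [SchwartzMap.lineDerivOp_apply_eq_fderiv]
  have hY : ContDiff ℝ 2 (Y : V → ℂ) := Y.smooth 2
  have h1 : ∀ u : V, fderiv ℝ (fun y => fderiv ℝ (Y : V → ℂ) y u) x =
      (fderiv ℝ (fderiv ℝ (Y : V → ℂ)) x).flip u := by
    intro u
    have hd : DifferentiableAt ℝ (fderiv ℝ (Y : V → ℂ)) x :=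
      (hY.fderiv_right (m := 1) le_rfl).differentiable one_ne_zero x
    exact fderiv_clm_apply hd (differentiableAt_const u) |>.trans (by simp)
  change fderiv ℝ (fun y => fderiv ℝ (Y : V → ℂ) y w) x v = fderiv ℝ (fun y => fderiv ℝ (Y : V → ℂ) y v) x w
  rw [h1 w, h1 v, ContinuousLinearMap.flip_apply, ContinuousLinearMap.flip_apply]
  exact ((hY.contDiffAt).isSymmSndFDerivAt (by simp)).eq v w

/-- `∂^{m} (Y(· − a)) = (∂^{m} Y)(· − a)`. [folklore] -/
theorem iteratedLineDerivOp_compSubConstCLM {n : ℕ} (m : Fin n → V) (a : V) (Y : 𝓢(V, ℂ)) :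
    (∂^{m} (SchwartzMap.compSubConstCLM ℂ a Y) : 𝓢(V, ℂ)) = SchwartzMap.compSubConstCLM ℂ a (∂^{m} Y) := by
  induction n with
  | zero => simp
  | succ n ih =>
    rw [LineDeriv.iteratedLineDerivOp_succ_left, LineDeriv.iteratedLineDerivOp_succ_left, ih,
      lineDerivOp_compSubConstCLM]

/-- `∂^{m} ∂_w Y = ∂_w ∂^{m} Y`. [folklore] -/
theorem iteratedLineDerivOp_lineDerivOp {n : ℕ} (m : Fin n → V) (w : V) (Y : 𝓢(V, ℂ)) :
    (∂^{m} (∂_{w} Y) : 𝓢(V, ℂ)) = ∂_{w} (∂^{m} Y) := by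
  induction n with
  | zero => simp
  | succ n ih =>
    rw [LineDeriv.iteratedLineDerivOp_succ_left, LineDeriv.iteratedLineDerivOp_succ_left, ih,
      lineDerivOp_comm]

/-- `(∂_w)^[j]` commutes with translations. [folklore] -/
theorem iterate_lineDerivOp_compSubConstCLM (j : ℕ) (a w : V) (Y : 𝓢(V, ℂ)) :
    ((∂_{w} : 𝓢(V, ℂ) → 𝓢(V, ℂ))^[j] (SchwartzMap.compSubConstCLM ℂ a Y)) =
      SchwartzMap.compSubConstCLM ℂ a ((∂_{w} : 𝓢(V, ℂ) → 𝓢(V, ℂ))^[j] Y) := by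
  rw [← LineDeriv.iteratedLineDerivOp_const_eq_iter_lineDerivOp,
    ← LineDeriv.iteratedLineDerivOp_const_eq_iter_lineDerivOp, iteratedLineDerivOp_compSubConstCLM]

/-! ## The second-order Taylor estimate along a line -/

/-- The derivative of a Schwartz function along the line `s ↦ x − s w`:
`d/ds Z(x − s w) = −(∂_w Z)(x − s w)`. [folklore] -/
theorem hasDerivAt_apply_sub_smul (Z : 𝓢(V, ℂ)) (x w : V) (s : ℝ) :
    HasDerivAt (fun σ : ℝ => Z (x - σ • w)) (-((∂_{w} Z : 𝓢(V, ℂ)) (x - s • w))) s := by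
  have h1 : HasDerivAt (fun σ : ℝ => x - σ • w) (-w) s := by
    have := ((hasDerivAt_id s).smul_const w).const_sub x
    simpa using this
  have h2 := (Z.hasFDerivAt (x - s • w)).comp_hasDerivAt s h1
  rw [SchwartzMap.lineDerivOp_apply_eq_fderiv, ← map_neg]
  exact h2

/-- **Second-order Taylor estimate along a line.** For `0 < |ε| ≤ 1`,
`‖ε⁻¹ (Y(x − εw) − Y(x)) + (∂_w Y)(x)‖ ≤ |ε| · B` whenever `‖(∂_w ∂_w Y)(x − s w)‖ ≤ B` for
`|s| ≤ 1` (two applications of the mean value inequality). [folklore] -/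
theorem norm_slope_translate_add_lineDeriv_le (Y : 𝓢(V, ℂ)) (w x : V) {ε B : ℝ} (hε : ε ≠ 0)
    (hε1 : |ε| ≤ 1) (hB : ∀ s : ℝ, |s| ≤ 1 → ‖(∂_{w} (∂_{w} Y) : 𝓢(V, ℂ)) (x - s • w)‖ ≤ B) :
    ‖ε⁻¹ • (Y (x - ε • w) - Y x) + (∂_{w} Y : 𝓢(V, ℂ)) x‖ ≤ |ε| * B := by
  have hB0 : 0 ≤ B := (norm_nonneg _).trans (hB 0 (by simp))
  set e : ℝ → ℂ := fun s => (∂_{w} Y : 𝓢(V, ℂ)) (x - s • w) with he_def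
  have hI : ∀ s ∈ Set.uIcc (0 : ℝ) ε, |s| ≤ |ε| := fun s hs => by
    simpa using Set.abs_sub_left_of_mem_uIcc hs
  -- step 1: `e` is `B`-Lipschitz on the segment
  have he_lip : ∀ s ∈ Set.uIcc (0 : ℝ) ε, ‖e s - e 0‖ ≤ B * |s| := by
    intro s hs
    have h := Convex.norm_image_sub_le_of_norm_hasDerivWithin_le (f := e)
      (f' := fun σ => -((∂_{w} (∂_{w} Y) : 𝓢(V, ℂ)) (x - σ • w))) (s := Set.uIcc (0 : ℝ) ε)
      (x := 0) (y := s) (C := B)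
      (fun σ _ => (hasDerivAt_apply_sub_smul (∂_{w} Y) x w σ).hasDerivWithinAt)
      (fun σ hσ => by rw [norm_neg]; exact hB σ ((hI σ hσ).trans hε1))
      (convex_uIcc 0 ε) Set.left_mem_uIcc hs
    simpa using h
  -- step 2: `F σ = Y(x − σw) − Y x + σ e(0)` has derivative `e 0 − e σ`, of norm `≤ B |ε|`
  have hF : ∀ σ : ℝ, HasDerivAt (fun σ : ℝ => Y (x - σ • w) - Y x + σ • e 0) (-(e σ) + e 0) σ := by
    intro σ
    have := ((hasDerivAt_apply_sub_smul Y x w σ).sub_const (Y x)).fun_add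
      ((hasDerivAt_id σ).smul_const (e 0))
    simpa using this
  have hFb := Convex.norm_image_sub_le_of_norm_hasDerivWithin_le
    (f := fun σ : ℝ => Y (x - σ • w) - Y x + σ • e 0) (f' := fun σ => -(e σ) + e 0)
    (s := Set.uIcc (0 : ℝ) ε) (x := 0) (y := ε) (C := B * |ε|)
    (fun σ _ => (hF σ).hasDerivWithinAt)
    (fun σ hσ => by
      rw [show -(e σ) + e 0 = -(e σ - e 0) by ring, norm_neg]
      exact (he_lip σ hσ).trans (mul_le_mul_of_nonneg_left (hI σ hσ) hB0))
    (convex_uIcc 0 ε) Set.left_mem_uIcc Set.right_mem_uIcc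
  simp only [zero_smul, sub_zero, sub_self, zero_add, Real.norm_eq_abs] at hFb
  -- conclusion
  have he0 : (∂_{w} Y : 𝓢(V, ℂ)) x = e 0 := by simp [he_def]
  have hkey : ε⁻¹ • (Y (x - ε • w) - Y x) + (∂_{w} Y : 𝓢(V, ℂ)) x =
      ε⁻¹ • (Y (x - ε • w) - Y x + ε • e 0) := by
    rw [smul_add, smul_smul, inv_mul_cancel₀ hε, one_smul, he0]
  rw [hkey, norm_smul, norm_inv, Real.norm_eq_abs]
  calc |ε|⁻¹ * ‖Y (x - ε • w) - Y x + ε • e 0‖ ≤ |ε|⁻¹ * (B * |ε| * |ε|) := by gcongr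
    _ = |ε| * B := by field_simp


/-- Weighted form of `norm_slope_translate_add_lineDeriv_le`: a weight `c ≥ 0` may be carried
through the estimate. [folklore] -/
theorem mul_norm_slope_translate_add_lineDeriv_le (Y : 𝓢(V, ℂ)) (w x : V) {ε B c : ℝ} (hε : ε ≠ 0)
    (hε1 : |ε| ≤ 1) (hc : 0 ≤ c)
    (hB : ∀ s : ℝ, |s| ≤ 1 → c * ‖(∂_{w} (∂_{w} Y) : 𝓢(V, ℂ)) (x - s • w)‖ ≤ B) :
    c * ‖ε⁻¹ • (Y (x - ε • w) - Y x) + (∂_{w} Y : 𝓢(V, ℂ)) x‖ ≤ |ε| * B := by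
  have hB0 : 0 ≤ B := le_trans (mul_nonneg hc (norm_nonneg _)) (hB 0 (by simp))
  rcases hc.lt_or_eq with hc' | hc'
  · have h := norm_slope_translate_add_lineDeriv_le Y w x (B := B / c) hε hε1 fun s hs => by
      rw [le_div_iff₀ hc', mul_comm]; exact hB s hs
    calc c * ‖ε⁻¹ • (Y (x - ε • w) - Y x) + (∂_{w} Y : 𝓢(V, ℂ)) x‖ ≤ c * (|ε| * (B / c)) := by gcongr
      _ = |ε| * B := by field_simp
  · rw [← hc', zero_mul]; positivity

/-! ## Schwartz seminorms of the difference quotient -/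

/-- The weight transfer `‖x‖^k ≤ (1 + ‖w‖)^k (1 + ‖x − s w‖)^k` for `|s| ≤ 1`. [folklore] -/
theorem norm_pow_le_mul_one_add_norm_sub_smul_pow (x w : V) {s : ℝ} (hs : |s| ≤ 1) (k : ℕ) :
    ‖x‖ ^ k ≤ (1 + ‖w‖) ^ k * (1 + ‖x - s • w‖) ^ k := by
  rw [← mul_pow]
  refine pow_le_pow_left₀ (norm_nonneg _) ?_ k
  have h1 : ‖x‖ ≤ ‖x - s • w‖ + ‖s • w‖ := by
    calc ‖x‖ = ‖(x - s • w) + s • w‖ := by rw [sub_add_cancel]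
      _ ≤ ‖x - s • w‖ + ‖s • w‖ := norm_add_le _ _
  have h2 : ‖s • w‖ ≤ ‖w‖ := by
    rw [norm_smul, Real.norm_eq_abs]
    exact mul_le_of_le_one_left (norm_nonneg _) hs
  nlinarith [norm_nonneg (x - s • w), norm_nonneg w]

/-- **Pointwise weighted estimate of the difference quotient**: for `0 < |ε| ≤ 1` and directions
`m : Fin n → V`,
`‖x‖^k ‖Dⁿ(ε⁻¹(Y(· − εw) − Y) + ∂_w Y)(x) m‖ ≤ |ε| 2^k (1 + ‖w‖)^k ‖w‖² |Y|_{k+n+2} ∏ ‖mᵢ‖`. [folklore] -/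
theorem norm_pow_mul_norm_iteratedFDeriv_slope_apply_le (Y : 𝓢(V, ℂ)) (w : V) (k n : ℕ) {ε : ℝ}
    (hε : ε ≠ 0) (hε1 : |ε| ≤ 1) (x : V) (m : Fin n → V) :
    ‖x‖ ^ k * ‖iteratedFDeriv ℝ n
        ((ε⁻¹ • (SchwartzMap.compSubConstCLM ℂ (ε • w) Y - Y) + ∂_{w} Y : 𝓢(V, ℂ)) : V → ℂ) x m‖ ≤
      |ε| * (2 ^ k * (1 + ‖w‖) ^ k * ‖w‖ ^ 2 * schwartzNorm (k + n + 2) Y) * ∏ i, ‖m i‖ := by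
  rw [← SchwartzMap.iteratedLineDerivOp_eq_iteratedFDeriv]
  have hcomm : (∂^{m} (ε⁻¹ • (SchwartzMap.compSubConstCLM ℂ (ε • w) Y - Y) + ∂_{w} Y) : 𝓢(V, ℂ)) =
      ε⁻¹ • (SchwartzMap.compSubConstCLM ℂ (ε • w) (∂^{m} Y) - ∂^{m} Y) + ∂_{w} (∂^{m} Y) := by
    rw [LineDeriv.iteratedLineDerivOp_add, LineDeriv.iteratedLineDerivOp_smul, sub_eq_add_neg,
      LineDeriv.iteratedLineDerivOp_add, LineDeriv.iteratedLineDerivOp_neg,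
      iteratedLineDerivOp_compSubConstCLM, iteratedLineDerivOp_lineDerivOp, ← sub_eq_add_neg]
  rw [hcomm, add_apply, smul_apply, sub_apply, SchwartzMap.compSubConstCLM_apply, mul_assoc |ε|]
  refine mul_norm_slope_translate_add_lineDeriv_le (∂^{m} Y) w x hε hε1 (by positivity) fun s hs => ?_
  -- the weighted bound on `∂_w ∂_w ∂^{m} Y` along the segment
  set y : V := x - s • w with hy
  have hder : ‖(∂_{w} (∂_{w} (∂^{m} Y)) : 𝓢(V, ℂ)) y‖ ≤
      (‖w‖ * (‖w‖ * ∏ i, ‖m i‖)) * ‖iteratedFDeriv ℝ (n + 2) Y y‖ := by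
    have h := norm_iteratedFDeriv_iteratedLineDerivOp_le
      (Fin.cons w (Fin.cons w m) : Fin (n + 2) → V) Y 0 y
    rw [norm_iteratedFDeriv_zero, Fin.prod_univ_succ, Fin.prod_univ_succ,
      show 0 + (n + 1 + 1) = n + 2 by omega] at h
    simpa [LineDeriv.iteratedLineDerivOp_succ_left, Fin.tail_cons] using h
  have hw8 : (1 + ‖y‖) ^ k * ‖iteratedFDeriv ℝ (n + 2) Y y‖ ≤ 2 ^ k * schwartzNorm (k + n + 2) Y := by
    have h := SchwartzMap.one_add_le_sup_seminorm_apply (𝕜 := ℂ) (m := (k, n + 2))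
      (k := k) (n := n + 2) le_rfl le_rfl Y y
    refine h.trans ?_
    change 2 ^ k * ((Finset.Iic (k, n + 2)).sup (schwartzSeminormFamily ℂ V ℂ)) Y ≤
      2 ^ k * ((Finset.Iic (k + n + 2, k + n + 2)).sup (schwartzSeminormFamily ℂ V ℂ)) Y
    gcongr
    exact Seminorm.le_def.1 (Finset.sup_mono
      (Finset.Iic_subset_Iic.2 (Prod.mk_le_mk.2 ⟨by omega, by omega⟩))) Y
  have hxk := norm_pow_le_mul_one_add_norm_sub_smul_pow x w hs k
  have hS0 := schwartzNorm_nonneg (k + n + 2) Y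
  calc ‖x‖ ^ k * ‖(∂_{w} (∂_{w} (∂^{m} Y)) : 𝓢(V, ℂ)) (x - s • w)‖
      ≤ ((1 + ‖w‖) ^ k * (1 + ‖y‖) ^ k) *
          ((‖w‖ * (‖w‖ * ∏ i, ‖m i‖)) * ‖iteratedFDeriv ℝ (n + 2) Y y‖) :=
        mul_le_mul hxk hder (norm_nonneg _) (by positivity)
    _ = (1 + ‖w‖) ^ k * (‖w‖ * (‖w‖ * ∏ i, ‖m i‖)) *
          ((1 + ‖y‖) ^ k * ‖iteratedFDeriv ℝ (n + 2) Y y‖) := by ring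
    _ ≤ (1 + ‖w‖) ^ k * (‖w‖ * (‖w‖ * ∏ i, ‖m i‖)) * (2 ^ k * schwartzNorm (k + n + 2) Y) := by
        gcongr
    _ = 2 ^ k * (1 + ‖w‖) ^ k * ‖w‖ ^ 2 * schwartzNorm (k + n + 2) Y * ∏ i, ‖m i‖ := by ring

/-- **Every Schwartz seminorm of the difference quotient is `O(ε)`**:
`p_{k,n}(ε⁻¹(Y(· − εw) − Y) + ∂_w Y) ≤ |ε| · 2^k (1 + ‖w‖)^k ‖w‖² |Y|_{k+n+2}` for `0 < |ε| ≤ 1`.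
This is the differentiability of the translation orbit `t ↦ Y(· − t w)` in `𝓢`. [folklore] -/
theorem seminorm_slope_translate_add_lineDeriv_le (Y : 𝓢(V, ℂ)) (w : V) (k n : ℕ) {ε : ℝ}
    (hε : ε ≠ 0) (hε1 : |ε| ≤ 1) :
    SchwartzMap.seminorm ℂ k n (ε⁻¹ • (SchwartzMap.compSubConstCLM ℂ (ε • w) Y - Y) + ∂_{w} Y) ≤
      |ε| * (2 ^ k * (1 + ‖w‖) ^ k * ‖w‖ ^ 2 * schwartzNorm (k + n + 2) Y) := by
  have hS0 := schwartzNorm_nonneg (k + n + 2) Y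
  refine SchwartzMap.seminorm_le_bound ℂ k n _ (by positivity) fun x => ?_
  set Q : 𝓢(V, ℂ) := ε⁻¹ • (SchwartzMap.compSubConstCLM ℂ (ε • w) Y - Y) + ∂_{w} Y with hQ
  have h := ContinuousMultilinearMap.opNorm_le_bound (f := (‖x‖ ^ k : ℝ) • iteratedFDeriv ℝ n (Q : V → ℂ) x)
    (M := |ε| * (2 ^ k * (1 + ‖w‖) ^ k * ‖w‖ ^ 2 * schwartzNorm (k + n + 2) Y)) (by positivity)
    fun m => by
      rw [smul_apply, norm_smul, Real.norm_of_nonneg (by positivity)]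
      exact norm_pow_mul_norm_iteratedFDeriv_slope_apply_le Y w k n hε hε1 x m
  rwa [norm_smul, Real.norm_of_nonneg (by positivity)] at h

/-! ## Differentiability of translation orbits against a continuous functional -/

/-- A continuous linear functional on `𝓢(V, ℂ)` is bounded by a Schwartz norm of finite order
(`Seminorm.bound_of_continuous`). [folklore] -/
theorem exists_norm_apply_le_schwartzNorm (T : 𝓢(V, ℂ) →L[ℂ] ℂ) :
    ∃ (M : ℕ) (C : ℝ), 0 ≤ C ∧ ∀ F, ‖T F‖ ≤ C * schwartzNorm M F := by
  set q : Seminorm ℂ 𝓢(V, ℂ) := (normSeminorm ℂ ℂ).comp T.toLinearMap with hq_def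
  have hq : Continuous q := continuous_norm.comp T.continuous
  obtain ⟨s, C, -, hle⟩ := Seminorm.bound_of_continuous (schwartz_withSeminorms ℂ V ℂ) q hq
  obtain ⟨M, hM⟩ := NuclearExpansion.sup_seminorm_le_schwartzNorm (V := V) s
  refine ⟨M, C, C.coe_nonneg, fun F => ?_⟩
  have h1 : q F ≤ (C • s.sup (schwartzSeminormFamily ℂ V ℂ)) F := hle F
  rw [smul_apply, NNReal.smul_def, smul_eq_mul] at h1
  exact h1.trans (mul_le_mul_of_nonneg_left (hM F) C.coe_nonneg)

/-- The Schwartz norm of order `M` of the difference quotient is `O(ε)`. [folklore] -/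
theorem schwartzNorm_slope_translate_add_lineDeriv_le (Y : 𝓢(V, ℂ)) (w : V) (M : ℕ) {ε : ℝ}
    (hε : ε ≠ 0) (hε1 : |ε| ≤ 1) :
    schwartzNorm M (ε⁻¹ • (SchwartzMap.compSubConstCLM ℂ (ε • w) Y - Y) + ∂_{w} Y) ≤
      |ε| * (2 ^ M * (1 + ‖w‖) ^ M * ‖w‖ ^ 2 * schwartzNorm (M + M + 2) Y) := by
  have hS0 := schwartzNorm_nonneg (M + M + 2) Y
  refine Seminorm.finset_sup_apply_le (by positivity) fun i hi => ?_
  obtain ⟨hk, hl⟩ := Prod.mk_le_mk.1 (Finset.mem_Iic.1 hi)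
  rw [SchwartzMap.schwartzSeminormFamily_apply]
  refine (seminorm_slope_translate_add_lineDeriv_le Y w i.1 i.2 hε hε1).trans
    (mul_le_mul_of_nonneg_left ?_ (abs_nonneg ε))
  have h1 : (1 : ℝ) ≤ 1 + ‖w‖ := by linarith [norm_nonneg w]
  have hA : (2 : ℝ) ^ i.1 ≤ 2 ^ M := pow_le_pow_right₀ (by norm_num) hk
  have hB : (1 + ‖w‖) ^ i.1 ≤ (1 + ‖w‖) ^ M := pow_le_pow_right₀ h1 hk
  have hS : schwartzNorm (i.1 + i.2 + 2) Y ≤ schwartzNorm (M + M + 2) Y := schwartzNorm_mono (by omega) Y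
  have hS1 := schwartzNorm_nonneg (i.1 + i.2 + 2) Y
  exact mul_le_mul (mul_le_mul (mul_le_mul hA hB (by positivity) (by positivity)) le_rfl
    (by positivity) (by positivity)) hS hS1 (by positivity)

/-- **The translation orbit is differentiable against every continuous functional**: for
`T ∈ 𝓢(V, ℂ)'`, `t ↦ T (Y(· − t w))` has derivative `−T ((∂_w Y)(· − t w))` at every `t`. [folklore] -/
theorem hasDerivAt_apply_compSubConstCLM_smul (T : 𝓢(V, ℂ) →L[ℂ] ℂ) (Y : 𝓢(V, ℂ)) (w : V) (t : ℝ) :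
    HasDerivAt (fun s : ℝ => T (SchwartzMap.compSubConstCLM ℂ (s • w) Y))
      (-T (SchwartzMap.compSubConstCLM ℂ (t • w) (∂_{w} Y))) t := by
  obtain ⟨M, C, hC, hT⟩ := exists_norm_apply_le_schwartzNorm T
  set Yt : 𝓢(V, ℂ) := SchwartzMap.compSubConstCLM ℂ (t • w) Y with hYt
  set K : ℝ := 2 ^ M * (1 + ‖w‖) ^ M * ‖w‖ ^ 2 * schwartzNorm (M + M + 2) Yt with hK
  rw [hasDerivAt_iff_tendsto_slope_zero]
  have hslope : ∀ ε : ℝ, ε ≠ 0 →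
      ε⁻¹ • (T (SchwartzMap.compSubConstCLM ℂ ((t + ε) • w) Y) - T (SchwartzMap.compSubConstCLM ℂ (t • w) Y)) -
        (-T (SchwartzMap.compSubConstCLM ℂ (t • w) (∂_{w} Y))) =
      T (ε⁻¹ • (SchwartzMap.compSubConstCLM ℂ (ε • w) Yt - Yt) + ∂_{w} Yt) := by
    intro ε _
    have h1 : SchwartzMap.compSubConstCLM ℂ ((t + ε) • w) Y = SchwartzMap.compSubConstCLM ℂ (ε • w) Yt := by
      rw [hYt, SchwartzMap.compSubConstCLM_comp, add_smul]
    rw [h1, hYt, ← lineDerivOp_compSubConstCLM, map_add, ContinuousLinearMap.map_smul_of_tower, map_sub]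
    abel
  refine tendsto_iff_norm_sub_tendsto_zero.2 ?_
  have hbound : ∀ᶠ ε : ℝ in 𝓝[≠] 0,
      ‖ε⁻¹ • (T (SchwartzMap.compSubConstCLM ℂ ((t + ε) • w) Y) -
          T (SchwartzMap.compSubConstCLM ℂ (t • w) Y)) -
        (-T (SchwartzMap.compSubConstCLM ℂ (t • w) (∂_{w} Y)))‖ ≤ C * (|ε| * K) := by
    have hmem : {ε : ℝ | |ε| ≤ 1} ∩ {ε : ℝ | ε ≠ 0} ∈ 𝓝[≠] (0 : ℝ) := by
      refine Filter.inter_mem (mem_nhdsWithin_of_mem_nhds ?_) self_mem_nhdsWithin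
      have : Metric.closedBall (0 : ℝ) 1 ∈ 𝓝 (0 : ℝ) := Metric.closedBall_mem_nhds 0 one_pos
      filter_upwards [this] with ε hε
      simpa using hε
    filter_upwards [hmem] with ε hε
    obtain ⟨hε1, hε0⟩ := hε
    rw [hslope ε hε0]
    exact (hT _).trans (mul_le_mul_of_nonneg_left
      (schwartzNorm_slope_translate_add_lineDeriv_le Yt w M hε0 hε1) hC)
  refine squeeze_zero_norm' (by simpa only [norm_norm] using hbound) ?_
  have h0 : Tendsto (fun ε : ℝ => C * (|ε| * K)) (𝓝 0) (𝓝 (C * (|0| * K))) :=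
    ((continuous_const.mul (continuous_abs.mul continuous_const)).tendsto 0)
  rw [abs_zero, zero_mul, mul_zero] at h0
  exact h0.mono_left nhdsWithin_le_nhds

/-- **Iterated form**: with `Gⱼ(t) = (−1)ʲ T ((∂_wʲ Y)(· − t w))`, `Gⱼ' = Gⱼ₊₁`. [folklore] -/
theorem hasDerivAt_iterate_lineDerivOp_translate (T : 𝓢(V, ℂ) →L[ℂ] ℂ) (Y : 𝓢(V, ℂ)) (w : V)
    (j : ℕ) (t : ℝ) :
    HasDerivAt (fun s : ℝ => (-1 : ℂ) ^ j *
        T (SchwartzMap.compSubConstCLM ℂ (s • w) ((∂_{w} : 𝓢(V, ℂ) → 𝓢(V, ℂ))^[j] Y)))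
      ((-1 : ℂ) ^ (j + 1) *
        T (SchwartzMap.compSubConstCLM ℂ (t • w) ((∂_{w} : 𝓢(V, ℂ) → 𝓢(V, ℂ))^[j + 1] Y))) t := by
  have h := (hasDerivAt_apply_compSubConstCLM_smul T ((∂_{w} : 𝓢(V, ℂ) → 𝓢(V, ℂ))^[j] Y) w t).const_mul
    ((-1 : ℂ) ^ j)
  have heq : (-1 : ℂ) ^ j * -T (SchwartzMap.compSubConstCLM ℂ (t • w)
      (∂_{w} ((∂_{w} : 𝓢(V, ℂ) → 𝓢(V, ℂ))^[j] Y))) = (-1 : ℂ) ^ (j + 1) *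
        T (SchwartzMap.compSubConstCLM ℂ (t • w) ((∂_{w} : 𝓢(V, ℂ) → 𝓢(V, ℂ))^[j + 1] Y)) := by
    rw [Function.iterate_succ_apply', pow_succ]
    ring
  rw [heq] at h
  exact h

/-- **Sub-goal `TranslationOrbitDerivative`** (helper for stub `ChartDerivativeBounds`): the
derivative of the translation orbit of a Schwartz function against a continuous functional, in the
iterated form `d/dt [(−1)ʲ T((∂_wʲ Y)(· − t w))] = (−1)ʲ⁺¹ T((∂_wʲ⁺¹ Y)(· − t w))` (OS 1973 §4.1,
differentiability of `t ↦ T^t f` in `𝒮`). [folklore] -/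
theorem TranslationOrbitDerivative : ∀ {V : Type*} [NormedAddCommGroup V] [NormedSpace ℝ V] (T : SchwartzMap V ℂ →L[ℂ] ℂ) (Y : SchwartzMap V ℂ) (w : V) (j : ℕ) (t : ℝ), HasDerivAt (fun s : ℝ => (-1 : ℂ) ^ j * T (SchwartzMap.compSubConstCLM ℂ (s • w) ((LineDeriv.lineDerivOp w : SchwartzMap V ℂ → SchwartzMap V ℂ)^[j] Y))) ((-1 : ℂ) ^ (j + 1) * T (SchwartzMap.compSubConstCLM ℂ (t • w) ((LineDeriv.lineDerivOp w : SchwartzMap V ℂ → SchwartzMap V ℂ)^[j + 1] Y))) t := by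
  intro V _ _ T Y w j t
  exact hasDerivAt_iterate_lineDerivOp_translate T Y w j t

end Summit.QuantumFields.YangMills.Theorems.CurvatureKernel
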